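import Summits.Ventures.PackingBounds.Configurations.E8Coords
import Summits.Ventures.PackingBounds.Configurations.E8Model
import Summits.Ventures.PackingBounds.Configurations.E8Roots

/-!
# Uniqueness of the `240`-point kissing configuration in `ℝ⁸` (Bannai–Sloane 1981, Theorem 7/8)

Framing: lottery ticket; floor = certified bounds/negative ranges. Venture `PackingBounds` (cell
`pub-packcert`, seat `pub-packcert-energy`).

**Theorem (Bannai–Sloane 1981; Conway–Sloane, SPLAG Ch. 14 Thm. 8).** There is a unique way, up to
isometry, to arrange `240` non-overlapping unit spheres in `ℝ⁸` so that they all touch another unit sphere: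
every `240`-point kissing configuration `C ⊂ S⁷` is the image of one fixed configuration — the `E₈` root
configuration in Hamming coordinates, `E8Model.hamModel` — under a linear isometry of `ℝ⁸`
(`exists_isometry_eq_image`); any two such configurations are isometric (`isometric_of_kissing`), in
particular each is isometric to the tree's explicit `E₈` configuration `Config.E8.pts`
(`isometric_E8Roots`), and `κ(8) = 240` holds with uniqueness (`kissing_dim8_unique`).

The tree's proof is NOT the one in SPLAG (which invokes the classification of root lattices): it is the
classification-free chain `E8Moments` (design moments about external directions) → `E8Closure`
(antipodality, closure under root addition via `κ(8) ≤ 240`) → `E8PairCounts` (pair count `12`, triple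
existence) → `E8Frame` (a `D₄`-frame inside `C`) → `E8Glue`/`E8Basis` (glue system) → `E8Coords` (an
orthonormal basis with half-integral coordinates and four integral parity functionals) → here: the integer
coordinate vector `m = 2⟨f, y⟩ ∈ ℤ⁸` of a point has `Σ mᵢ² = 4` (Parseval) and satisfies the parities, so
`m ∈ hamList` (`E8Model.mem_hamList`), i.e. `C ⊆ Φ(hamModel)`; `|C| = 240 ≥ |hamModel|` gives equality.

## References
* E. Bannai, N. J. A. Sloane, *Uniqueness of certain spherical codes*, Canad. J. Math. 33 (1981) 437–449
  (= Conway–Sloane, *SPLAG*, Ch. 14, Theorems 7–8). [`ConwaySloane1999`]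
-/

namespace Summit.Ventures.PackingBounds.Config.E8Unique

open Finset WithLp E8Model

section config

variable {C : Finset (EuclideanSpace ℝ (Fin 8))} (h1 : ∀ x ∈ C, ‖x‖ = 1)
  (h2 : ∀ x ∈ C, ∀ y ∈ C, x ≠ y → inner ℝ x y ≤ 1 / 2) (hcard : C.card = 240)
include h1 h2 hcard

/-- **Uniqueness of the `E₈` kissing configuration (Bannai–Sloane).** Every configuration of `240` unit
vectors in `ℝ⁸` with pairwise inner products `≤ 1/2` is the image of the fixed model `hamModel` under a
linear isometry of `ℝ⁸`. [cite: ConwaySloane1999, Ch. 14 Thm. 7] -/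
theorem exists_isometry_eq_image :
    ∃ Φ : EuclideanSpace ℝ (Fin 8) ≃ₗᵢ[ℝ] EuclideanSpace ℝ (Fin 8), C = hamModel.image Φ := by
  classical
  obtain ⟨f, hf, hhalf, hp1, hp2, hp3, hp4⟩ := E8Coords.exists_halfIntegralBasis h1 h2 hcard
  have hcardι : Fintype.card (Fin 8) = Module.finrank ℝ (EuclideanSpace ℝ (Fin 8)) := by
    rw [finrank_euclideanSpace_fin, Fintype.card_fin]
  obtain ⟨b, hb⟩ : ∃ b : OrthonormalBasis (Fin 8) ℝ (EuclideanSpace ℝ (Fin 8)), ∀ k, b k = f k :=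
    ⟨OrthonormalBasis.mk hf (hf.linearIndependent.span_eq_top_of_card_eq_finrank' hcardι).ge,
      fun k => by rw [OrthonormalBasis.coe_mk]⟩
  refine ⟨b.repr.symm, ?_⟩
  have hsub : C ⊆ hamModel.image b.repr.symm := by
    intro y hy
    choose m hm using hhalf y hy
    have hcoord : ∀ i, inner ℝ (f i) y = (m i : ℝ) / 2 := fun i => by linarith [hm i]
    -- coordinates: `b.repr y = m / 2`
    have hrepr : b.repr y = toVec m := by
      refine PiLp.ext fun i => ?_
      rw [OrthonormalBasis.repr_apply_apply, hb, toVec, PiLp.toLp_apply, hcoord]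
    -- sum of squares (Parseval)
    have hsq : ∑ i, m i ^ 2 = 4 := by
      have hP := b.sum_inner_mul_inner y y
      rw [real_inner_self_eq_norm_sq, h1 y hy, one_pow] at hP
      have hterm : ∀ i, inner ℝ y (b i) * inner ℝ (b i) y = ((m i : ℝ) ^ 2) / 4 := by
        intro i
        rw [real_inner_comm (b i) y, hb, hcoord]
        ring
      simp only [hterm] at hP
      rw [← Finset.sum_div] at hP
      have hP' : ∑ i, (m i : ℝ) ^ 2 = 4 := by linarith
      exact_mod_cast hP'
    -- parities
    have par : ∀ i j k l : Fin 8, (∃ n : ℤ, inner ℝ (f i + f j + f k + f l) y = n) →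
        (m i + m j + m k + m l) % 2 = 0 := by
      rintro i j k l ⟨n, hn⟩
      rw [inner_add_left, inner_add_left, inner_add_left, hcoord, hcoord, hcoord, hcoord] at hn
      have : ((m i + m j + m k + m l : ℤ) : ℝ) = 2 * n := by push_cast; linarith
      have h2 : m i + m j + m k + m l = 2 * n := by exact_mod_cast this
      omega
    have q1 := par 0 1 2 3 (hp1 y hy)
    have q2 := par 0 1 4 5 (hp2 y hy)
    have q3 := par 0 1 6 7 (hp3 y hy)
    have q4 := par 0 2 4 6 (hp4 y hy)
    have hmem : rowOf m ∈ hamRows := rowOf_mem_hamRows m hsq q1 q2 q3 q4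
    rw [Finset.mem_image]
    exact ⟨toVec m, toVec_mem_hamModel hmem, by rw [← hrepr]; exact b.repr.symm_apply_apply y⟩
  have hle : (hamModel.image (b.repr.symm : EuclideanSpace ℝ (Fin 8) → EuclideanSpace ℝ (Fin 8))).card
      ≤ C.card :=
    Finset.card_image_le.trans (card_hamModel_le.trans hcard.ge)
  exact Finset.eq_of_subset_of_card_le hsub hle

end config

/-- **Any two `240`-point kissing configurations of `ℝ⁸` are isometric** (SPLAG Ch. 14 Thm. 8: there is a
unique way up to isometry to arrange `240` unit spheres touching a central unit sphere in `ℝ⁸`).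
[cite: ConwaySloane1999, Ch. 14 Thm. 8] -/
theorem isometric_of_kissing (C C' : Finset (EuclideanSpace ℝ (Fin 8)))
    (h1 : ∀ x ∈ C, ‖x‖ = 1) (h2 : ∀ x ∈ C, ∀ y ∈ C, x ≠ y → inner ℝ x y ≤ 1 / 2) (hcard : C.card = 240)
    (h1' : ∀ x ∈ C', ‖x‖ = 1) (h2' : ∀ x ∈ C', ∀ y ∈ C', x ≠ y → inner ℝ x y ≤ 1 / 2)
    (hcard' : C'.card = 240) :
    ∃ Ψ : EuclideanSpace ℝ (Fin 8) ≃ₗᵢ[ℝ] EuclideanSpace ℝ (Fin 8), C' = C.image Ψ := by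
  classical
  obtain ⟨Φ, hΦ⟩ := exists_isometry_eq_image h1 h2 hcard
  obtain ⟨Φ', hΦ'⟩ := exists_isometry_eq_image h1' h2' hcard'
  refine ⟨Φ.symm.trans Φ', ?_⟩
  rw [hΦ', hΦ, Finset.image_image]
  congr 1
  funext x
  simp

/-- **Every `240`-point kissing configuration of `ℝ⁸` is isometric to the `E₈` root configuration**
`Config.E8.pts` of the tree (so `κ(8) = 240` is attained by exactly one configuration up to isometry).
[cite: ConwaySloane1999, Ch. 14 Thm. 8] -/
theorem isometric_E8Roots (C : Finset (EuclideanSpace ℝ (Fin 8)))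
    (h1 : ∀ x ∈ C, ‖x‖ = 1) (h2 : ∀ x ∈ C, ∀ y ∈ C, x ≠ y → inner ℝ x y ≤ 1 / 2) (hcard : C.card = 240) :
    ∃ Ψ : EuclideanSpace ℝ (Fin 8) ≃ₗᵢ[ℝ] EuclideanSpace ℝ (Fin 8), C = E8.pts.image Ψ :=
  isometric_of_kissing E8.pts C E8.norm_pts E8.inner_pts_le E8.card_pts h1 h2 hcard

/-- **`κ(8) = 240` with uniqueness**: the kissing number in dimension `8` is `240`, and the optimal
configuration is unique up to isometry. [cite: ConwaySloane1999, Ch. 14 Thm. 8] -/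
theorem kissing_dim8_unique :
    IsGreatest {N : ℕ | ∃ C : Finset (EuclideanSpace ℝ (Fin 8)),
      C.card = N ∧ (∀ x ∈ C, ‖x‖ = 1) ∧ (∀ x ∈ C, ∀ y ∈ C, x ≠ y → inner ℝ x y ≤ 1 / 2)} 240 ∧
    ∀ C C' : Finset (EuclideanSpace ℝ (Fin 8)),
      (∀ x ∈ C, ‖x‖ = 1) → (∀ x ∈ C, ∀ y ∈ C, x ≠ y → inner ℝ x y ≤ 1 / 2) → C.card = 240 →
      (∀ x ∈ C', ‖x‖ = 1) → (∀ x ∈ C', ∀ y ∈ C', x ≠ y → inner ℝ x y ≤ 1 / 2) → C'.card = 240 →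
      ∃ Ψ : EuclideanSpace ℝ (Fin 8) ≃ₗᵢ[ℝ] EuclideanSpace ℝ (Fin 8), C' = C.image Ψ :=
  ⟨E8.kissing_dim8_isGreatest, fun C C' h1 h2 hc h1' h2' hc' =>
    isometric_of_kissing C C' h1 h2 hc h1' h2' hc'⟩

/-- **The model is itself an optimal kissing configuration**: `hamModel` consists of `240` unit vectors with
pairwise inner products `≤ 1/2` (it is an isometric copy of `Config.E8.pts`). -/
theorem hamModel_kissing : hamModel.card = 240 ∧ (∀ x ∈ hamModel, ‖x‖ = 1) ∧
    (∀ x ∈ hamModel, ∀ y ∈ hamModel, x ≠ y → inner ℝ x y ≤ 1 / 2) := by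
  classical
  obtain ⟨Φ, hΦ⟩ := exists_isometry_eq_image E8.norm_pts E8.inner_pts_le E8.card_pts
  have hcard : hamModel.card = 240 := by
    refine le_antisymm card_hamModel_le ?_
    have h := Finset.card_image_le (s := hamModel) (f := (Φ : _ → EuclideanSpace ℝ (Fin 8)))
    rw [← hΦ, E8.card_pts] at h
    exact h
  have hmem : ∀ x ∈ hamModel, Φ x ∈ E8.pts := fun x hx => by
    rw [hΦ]; exact Finset.mem_image_of_mem _ hx
  refine ⟨hcard, fun x hx => ?_, fun x hx y hy hxy => ?_⟩
  · rw [← Φ.norm_map x]; exact E8.norm_pts _ (hmem x hx)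
  · rw [← Φ.inner_map_map x y]
    exact E8.inner_pts_le _ (hmem x hx) _ (hmem y hy) (fun h => hxy (Φ.injective h))

end Summit.Ventures.PackingBounds.Config.E8Unique
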